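import Literature.Barriers.CriticalPhenomena.KozmaNachmiasLemma11Steps
import Literature.Probability.Percolation.CorrelationLengthDKTBoundary
import Literature.Probability.Percolation.CriticalContinuityProofs
import HarnessLib

/-!
# Crux `PercShatteringRace.NearLinearTwoClusterDecay` (stmt-CriticalPhenomena-5785) — frontier stub V1 `stub_vdbdGoodPath`

Helper file of the line `pair-decay-long-arms-dense` (lead c13); lands with `--supports stmt-CriticalPhenomena-5785`
(registered stub `stub_vdbdGoodPath` of skeleton rev L14-c13, § Point-to-point frontier).

## Statement

`stub_vdbdGoodPath` (van den Berg–Don 2020, Lemma 8(b), for bond percolation on `ℤ³` at `p = p_c`):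
call `v ∈ Λ_n := box 3 n` GOOD if `P_{p_c}(0 ↔ v in Λ_n) ≥ q_n := 1/(6|Λ_n|)`. Then for every `n` there
is a lattice path `f(0) = 0, f(1), …, f(k)` of good points of `Λ_n`, consecutive points `zdGraph`-adjacent,
ending in the inner vertex boundary `∂ⁱⁿΛ_n`.

## Proof sketch

* Let `T ⊆ Λ_n` be the set of good points and `H` the graph on `ℤ³` whose edges are the lattice edges
  with both endpoints in `T` (`((⊤ : (zdGraph 3).Subgraph).induce ↑T).spanningCoe`); let `Γ ⊆ Λ_n` be
  the set of points reachable from `0` in `H` (`0` is good: `P(0 ↔ 0 in Λ_n) = 1`).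
* Suppose no point of `∂ⁱⁿΛ_n` is reachable. Duminil-Copin–Tassion at criticality (Kozma–Nachmias
  Lemma 3.1 in the tree, `one_le_phi_criticalProbI`): `1 ≤ φ_{p_c}(Γ) = p_c Σ_{x ∈ Γ, y ∼ x, y ∉ Γ} P(0 ↔ x in Γ)`.
  The double sum has at most `6|Γ| ≤ 6|Λ_n|` terms, so (pigeonhole) some `x ∈ Γ` with a neighbour
  `y ∉ Γ` has `P(0 ↔ x in Γ) ≥ 1/(6|Λ_n| p_c)`.
* `x ∉ ∂ⁱⁿΛ_n`, so `y ∈ Λ_n`; opening the edge `{x, y}` independently (as in `DKT20.exists_face_point`),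
  `P(0 ↔ y in Λ_n) ≥ P(0 ↔ x in Γ) · p_c ≥ q_n`: `y` is good and `H`-adjacent to `x`, hence `y ∈ Γ`,
  a contradiction.
* So some `v ∈ ∂ⁱⁿΛ_n` is `H`-reachable from `0`; read the path off an `H`-walk (`Walk.getVert`): all its
  vertices are good, as every edge of `H` has good endpoints.

## References

* J. van den Berg, H. Don, *A lower bound for point-to-point connection probabilities in critical
  percolation*, Electron. Commun. Probab. 25 (2020), arXiv:1912.10964, Definition 7 and Lemma 8(b)
  [VandenbergDon2020].
* H. Duminil-Copin, V. Tassion, *A new proof of the sharpness of the phase transition for Bernoulli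
  percolation and the Ising model*, Enseign. Math. 62 (2016) 199–206, §1 and Thm 1.1
  [DuminilCopinTassionEM2016].
* G. Kozma, A. Nachmias, *Arm exponents in high dimensional percolation*, J. Amer. Math. Soc. 24
  (2011) 375–409, Lemma 3.1 [KozmaNachmias2011].
* G. Grimmett, *Percolation*, 2nd ed., Springer 1999, §1.4 Theorem (1.10), §2.2 [Grimmett1999].
-/

noncomputable section

namespace Summit.CriticalPhenomena.PercolationContinuityZ3.Theorems

namespace NearLinearTwoClusterDecayVdbdGoodPath

open MeasureTheory
open Literature.Probability.LatticeModels Literature.Probability.Percolation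

/-- Adjacency in the graph `H_T` of lattice edges with both endpoints in `T`
(`((⊤ : (zdGraph 3).Subgraph).induce ↑T).spanningCoe`). [folklore] -/
theorem goodGraph_adj {T : Finset (Site 3)} {u v : Site 3} :
    ((⊤ : (zdGraph 3).Subgraph).induce (↑T : Set (Site 3))).spanningCoe.Adj u v ↔
      u ∈ T ∧ v ∈ T ∧ (zdGraph 3).Adj u v := Iff.rfl

/-- If `0 ∈ T`, every point reachable from `0` in `H_T` lies in `T` (the last edge certifies it). [folklore] -/
theorem mem_of_reachable {T : Finset (Site 3)} (h0 : (0 : Site 3) ∈ T) {v : Site 3}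
    (h : ((⊤ : (zdGraph 3).Subgraph).induce (↑T : Set (Site 3))).spanningCoe.Reachable 0 v) : v ∈ T := by
  obtain ⟨w⟩ := h.symm
  cases w with
  | nil => exact h0
  | cons hadj _ => exact (goodGraph_adj.1 hadj).1

/-- `|Λ_n| ≥ 1` (as `0 ∈ Λ_n`, `LatticeModels.zero_mem_box` of `ThermodynamicLimit`). [folklore] -/
theorem one_le_card_box (n : ℕ) : (1 : ℝ) ≤ ((box 3 n).card : ℝ) := by
  exact_mod_cast Finset.card_pos.2 ⟨0, zero_mem_box 3 n⟩

/-- `0` is good: `P_{p_c}(0 ↔ 0 in Λ_n) = 1 ≥ q_n = 1/(6|Λ_n|)`. [cite: VandenbergDon2020, Definition 7] -/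
theorem zero_good (n : ℕ) :
    (1 : ℝ) / (6 * ((box 3 n).card : ℝ)) ≤
      (bondPercolation (zdGraph 3) (criticalProbI 3)).real (openConnIn (↑(box 3 n) : Set (Site 3)) 0 0) := by
  have huniv : (openConnIn (↑(box 3 n) : Set (Site 3)) (0 : Site 3) 0 : Set (BondConfig (Site 3))) = Set.univ :=
    Set.eq_univ_of_forall fun ω =>
      Literature.Barriers.CriticalPhenomena.mem_openConnIn_rfl (Finset.mem_coe.2 (zero_mem_box 3 n)) ω
  rw [huniv, probReal_univ, div_le_one (by linarith [one_le_card_box n])]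
  linarith [one_le_card_box n]

open Classical in
/-- **The cluster of good points reaches the boundary** (van den Berg–Don 2020, proof of Lemma 8(b)):
if `T` is the set of good points of `Λ_n`, some point of `∂ⁱⁿΛ_n` is reachable from `0` in `H_T`.
Otherwise, with `Γ` the set of reachable points, `φ_{p_c}(Γ) ≥ 1` (Duminil-Copin–Tassion) produces,
by pigeonhole and by opening one boundary edge of `Γ` independently, a good neighbour `y ∈ Λ_n ∖ Γ` of
a point of `Γ`, which is absurd. [cite: VandenbergDon2020, Lemma 8] -/
theorem exists_reachable_mem_innerBoundary (n : ℕ) {T : Finset (Site 3)}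
    (hT : ∀ v : Site 3, v ∈ T ↔ v ∈ box 3 n ∧ (1 : ℝ) / (6 * ((box 3 n).card : ℝ)) ≤
      (bondPercolation (zdGraph 3) (criticalProbI 3)).real (openConnIn (↑(box 3 n) : Set (Site 3)) 0 v)) :
    ∃ v ∈ innerBoundary (zdGraph 3) (box 3 n),
      ((⊤ : (zdGraph 3).Subgraph).induce (↑T : Set (Site 3))).spanningCoe.Reachable 0 v := by
  -- the threshold `q = 1/(6|Λ_n|)`
  obtain ⟨q, hq⟩ : ∃ q : ℝ, q = (1 : ℝ) / (6 * ((box 3 n).card : ℝ)) := ⟨_, rfl⟩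
  rw [← hq] at hT
  -- the cluster `Γ` of `0` in `H_T`, inside `Λ_n`
  obtain ⟨Γ, hΓ⟩ : ∃ Γ : Finset (Site 3), Γ = (box 3 n).filter fun v =>
      ((⊤ : (zdGraph 3).Subgraph).induce (↑T : Set (Site 3))).spanningCoe.Reachable 0 v := ⟨_, rfl⟩
  have hmemΓ : ∀ {v : Site 3}, v ∈ Γ ↔ v ∈ box 3 n ∧
      ((⊤ : (zdGraph 3).Subgraph).induce (↑T : Set (Site 3))).spanningCoe.Reachable 0 v := by
    intro v
    rw [hΓ, Finset.mem_filter]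
  have h0T : (0 : Site 3) ∈ T := (hT 0).2 ⟨zero_mem_box 3 n, by rw [hq]; exact zero_good n⟩
  have h0Γ : (0 : Site 3) ∈ Γ := hmemΓ.2 ⟨zero_mem_box 3 n, SimpleGraph.Reachable.refl 0⟩
  have hΓB : Γ ⊆ box 3 n := fun v hv => (hmemΓ.1 hv).1
  by_contra hno
  push Not at hno
  -- constants
  have hpc0 : 0 < ((criticalProbI 3 : unitInterval) : ℝ) := by
    rw [coe_criticalProbI]
    exact (Grimmett1999_criticalProb_pos_lt_one_holds 3 (by norm_num)).1
  have hBcard : (1 : ℝ) ≤ ((box 3 n).card : ℝ) := one_le_card_box n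
  have hBne : ((box 3 n).card : ℝ) ≠ 0 := (one_pos.trans_le hBcard).ne'
  have hpcne : ((criticalProbI 3 : unitInterval) : ℝ) ≠ 0 := hpc0.ne'
  have hq0 : 0 < q := by
    rw [hq]
    exact one_div_pos.2 (by linarith)
  have ht0 : 0 < q / ((criticalProbI 3 : unitInterval) : ℝ) := div_pos hq0 hpc0
  -- Duminil-Copin–Tassion at criticality: `1 ≤ φ_{p_c}(Γ)`
  have hφ := Literature.Barriers.CriticalPhenomena.one_le_phi_criticalProbI (d := 3) (by norm_num) Γ h0Γ
  rw [DCT16.phi_def] at hφ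
  -- pigeonhole
  have hex : ∃ x ∈ Γ, ∃ y ∈ ((zdGraph 3).neighborFinset x).filter (fun y => y ∉ Γ),
      q / ((criticalProbI 3 : unitInterval) : ℝ) ≤
        (bondPercolation (zdGraph 3) (criticalProbI 3)).real (openConnIn (↑Γ : Set (Site 3)) 0 x) := by
    by_contra hno'
    push Not at hno'
    -- some point of `Γ` has a neighbour outside `Γ` (else the double sum vanishes)
    have hne : ∃ x ∈ Γ, (((zdGraph 3).neighborFinset x).filter (fun y => y ∉ Γ)).Nonempty := by
      by_contra hall
      push Not at hall
      have h0 : ∑ x ∈ Γ, ∑ y ∈ (zdGraph 3).neighborFinset x with y ∉ Γ,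
          (bondPercolation (zdGraph 3) (criticalProbI 3)).real (openConnIn (↑Γ : Set (Site 3)) 0 x) = 0 :=
        Finset.sum_eq_zero fun x hx => by rw [hall x hx, Finset.sum_empty]
      rw [h0, mul_zero] at hφ
      linarith
    obtain ⟨x₀, hx₀, hne₀⟩ := hne
    have hlt : ∑ x ∈ Γ, ∑ y ∈ (zdGraph 3).neighborFinset x with y ∉ Γ,
          (bondPercolation (zdGraph 3) (criticalProbI 3)).real (openConnIn (↑Γ : Set (Site 3)) 0 x) <
        ∑ x ∈ Γ, ∑ _y ∈ (zdGraph 3).neighborFinset x with _y ∉ Γ, q / ((criticalProbI 3 : unitInterval) : ℝ) :=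
      Finset.sum_lt_sum (fun x hx => Finset.sum_le_sum fun y hy => (hno' x hx y hy).le)
        ⟨x₀, hx₀, Finset.sum_lt_sum_of_nonempty hne₀ fun y hy => hno' x₀ hx₀ y hy⟩
    have hle : ∑ x ∈ Γ, ∑ _y ∈ (zdGraph 3).neighborFinset x with _y ∉ Γ, q / ((criticalProbI 3 : unitInterval) : ℝ) ≤
        1 / ((criticalProbI 3 : unitInterval) : ℝ) := by
      calc ∑ x ∈ Γ, ∑ _y ∈ (zdGraph 3).neighborFinset x with _y ∉ Γ, q / ((criticalProbI 3 : unitInterval) : ℝ)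
          ≤ ∑ _x ∈ Γ, 6 * (q / ((criticalProbI 3 : unitInterval) : ℝ)) := by
            refine Finset.sum_le_sum fun x _ => ?_
            rw [Finset.sum_const, nsmul_eq_mul]
            refine mul_le_mul_of_nonneg_right ?_ ht0.le
            have h1 : (((zdGraph 3).neighborFinset x).filter (fun y => y ∉ Γ)).card ≤
                ((zdGraph 3).neighborFinset x).card := Finset.card_filter_le _ _
            rw [card_neighborFinset_zdGraph_holds] at h1
            have h6 : (((zdGraph 3).neighborFinset x).filter (fun y => y ∉ Γ)).card ≤ 6 := by omega
            exact_mod_cast h6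
        _ = Γ.card * (6 * (q / ((criticalProbI 3 : unitInterval) : ℝ))) := by
            rw [Finset.sum_const, nsmul_eq_mul]
        _ ≤ (box 3 n).card * (6 * (q / ((criticalProbI 3 : unitInterval) : ℝ))) :=
            mul_le_mul_of_nonneg_right (by exact_mod_cast Finset.card_le_card hΓB)
              (mul_nonneg (by norm_num) ht0.le)
        _ = 1 / ((criticalProbI 3 : unitInterval) : ℝ) := by
            rw [hq]
            field_simp
    have hlt1 : ((criticalProbI 3 : unitInterval) : ℝ) *
        ∑ x ∈ Γ, ∑ y ∈ (zdGraph 3).neighborFinset x with y ∉ Γ,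
          (bondPercolation (zdGraph 3) (criticalProbI 3)).real (openConnIn (↑Γ : Set (Site 3)) 0 x) < 1 := by
      calc ((criticalProbI 3 : unitInterval) : ℝ) * _
          < ((criticalProbI 3 : unitInterval) : ℝ) * (1 / ((criticalProbI 3 : unitInterval) : ℝ)) :=
            mul_lt_mul_of_pos_left (hlt.trans_le hle) hpc0
        _ = 1 := mul_one_div_cancel hpcne
    linarith
  obtain ⟨x, hx, y, hy, hxt⟩ := hex
  rw [Finset.mem_filter, SimpleGraph.mem_neighborFinset] at hy
  obtain ⟨hadj, hyΓ⟩ := hy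
  have hxB : x ∈ box 3 n := hΓB hx
  have hxr : ((⊤ : (zdGraph 3).Subgraph).induce (↑T : Set (Site 3))).spanningCoe.Reachable 0 x := (hmemΓ.1 hx).2
  have hxT : x ∈ T := mem_of_reachable h0T hxr
  -- `x ∉ ∂ⁱⁿΛ_n` (it is reachable), so its neighbour `y` lies in `Λ_n`
  have hyB : y ∈ box 3 n := by
    by_contra hyB
    exact hno x (mem_innerBoundary_iff.2 ⟨hxB, y, hyB, hadj⟩) hxr
  -- open the boundary edge `{x, y}` independently
  have hsub : (openConnIn (↑Γ : Set (Site 3)) 0 x ∩ {ω | s(x, y) ∈ ω} : Set (BondConfig (Site 3))) ⊆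
      openConnIn (↑(box 3 n) : Set (Site 3)) 0 y := by
    rintro ω ⟨h1, h2⟩
    exact GM.openConnIn_trans (openConnIn_mono (Finset.coe_subset.2 hΓB) 0 x h1)
      (GM.openConnIn_of_adj (Finset.mem_coe.2 hxB) (Finset.mem_coe.2 hyB)
        ((openGraph_adj ω x y).2 ⟨h2, hadj.ne⟩))
  have hdet : DeterminedBy (openConnIn (↑Γ : Set (Site 3)) (0 : Site 3) x) ↑(Γ.sym2) :=
    DCT16.determinedBy_openConnIn _ 0 x (by rw [Finset.coe_sym2])
  have hdisj : Disjoint Γ.sym2 {s(x, y)} := by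
    rw [Finset.disjoint_singleton_right, Finset.mk_mem_sym2_iff]
    exact fun h => hyΓ h.2
  have hind := DCT16.real_inter_of_determinedBy_disjoint (zdGraph 3) (criticalProbI 3) hdet
    ((determinedBy_mem (s(x, y))).mono (by simp)) hdisj
  have hedge : (bondPercolation (zdGraph 3) (criticalProbI 3)).real {ω | s(x, y) ∈ ω} =
      ((criticalProbI 3 : unitInterval) : ℝ) :=
    bondPercolation_cylinder (zdGraph 3) (criticalProbI 3) ((SimpleGraph.mem_edgeSet _).2 hadj)
  -- hence `y` is good …
  have hyT : y ∈ T := by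
    refine (hT y).2 ⟨hyB, ?_⟩
    calc q = q / ((criticalProbI 3 : unitInterval) : ℝ) * ((criticalProbI 3 : unitInterval) : ℝ) :=
          (div_mul_cancel₀ q hpcne).symm
      _ ≤ (bondPercolation (zdGraph 3) (criticalProbI 3)).real (openConnIn (↑Γ : Set (Site 3)) 0 x) *
            (bondPercolation (zdGraph 3) (criticalProbI 3)).real {ω | s(x, y) ∈ ω} := by
          rw [hedge]; exact mul_le_mul_of_nonneg_right hxt hpc0.le
      _ = (bondPercolation (zdGraph 3) (criticalProbI 3)).real
            (openConnIn (↑Γ : Set (Site 3)) 0 x ∩ {ω | s(x, y) ∈ ω}) := hind.symm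
      _ ≤ (bondPercolation (zdGraph 3) (criticalProbI 3)).real (openConnIn (↑(box 3 n) : Set (Site 3)) 0 y) :=
          measureReal_mono hsub
  -- … and reachable from `0` in `H_T`: `y ∈ Γ`, a contradiction
  exact hyΓ (hmemΓ.2 ⟨hyB, hxr.trans (SimpleGraph.Adj.reachable (goodGraph_adj.2 ⟨hxT, hyT, hadj⟩))⟩)

end NearLinearTwoClusterDecayVdbdGoodPath

open MeasureTheory
open Literature.Probability.LatticeModels Literature.Probability.Percolation
open NearLinearTwoClusterDecayVdbdGoodPath

/-- **Frontier stub V1 `stub_vdbdGoodPath` of the line `pair-decay-long-arms-dense`** (registered) —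
van den Berg–Don 2020, Lemma 8(b), for bond percolation on `ℤ³` at `p = p_c`: for every `n` there is a
lattice path `f(0) = 0, …, f(k) ∈ ∂ⁱⁿΛ_n` of GOOD points of `Λ_n`
(`P_{p_c}(0 ↔ f(j) in Λ_n) ≥ 1/(6|Λ_n|)`), consecutive points `zdGraph 3`-adjacent. Read off a walk from
`0` to `∂ⁱⁿΛ_n` in the graph of lattice edges between good points (`exists_reachable_mem_innerBoundary`).
[cite: VandenbergDon2020, Lemma 8] -/
theorem stub_vdbdGoodPath :
    ∀ n : ℕ, ∃ k : ℕ, ∃ f : ℕ → Site 3, f 0 = 0 ∧ f k ∈ innerBoundary (zdGraph 3) (box 3 n) ∧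
      (∀ j < k, (zdGraph 3).Adj (f j) (f (j + 1))) ∧
      ∀ j ≤ k, f j ∈ box 3 n ∧
        (1 : ℝ) / (6 * ((box 3 n).card : ℝ)) ≤
          (bondPercolation (zdGraph 3) (criticalProbI 3)).real (openConnIn (↑(box 3 n) : Set (Site 3)) 0 (f j)) := by
  intro n
  -- the good points of `Λ_n`
  have hT : ∀ v : Site 3, v ∈ (box 3 n).filter (fun v => (1 : ℝ) / (6 * ((box 3 n).card : ℝ)) ≤
      (bondPercolation (zdGraph 3) (criticalProbI 3)).real (openConnIn (↑(box 3 n) : Set (Site 3)) 0 v)) ↔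
        v ∈ box 3 n ∧ (1 : ℝ) / (6 * ((box 3 n).card : ℝ)) ≤
          (bondPercolation (zdGraph 3) (criticalProbI 3)).real (openConnIn (↑(box 3 n) : Set (Site 3)) 0 v) :=
    fun v => Finset.mem_filter
  obtain ⟨v, hvbd, ⟨w⟩⟩ := exists_reachable_mem_innerBoundary n hT
  have h0T := (hT 0).2 ⟨zero_mem_box 3 n, zero_good n⟩
  refine ⟨w.length, fun j => w.getVert j, w.getVert_zero, ?_,
    fun j hj => (goodGraph_adj.1 (w.adj_getVert_succ hj)).2.2,
    fun j _ => (hT _).1 (mem_of_reachable h0T ⟨w.take j⟩)⟩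
  show w.getVert w.length ∈ innerBoundary (zdGraph 3) (box 3 n)
  rw [w.getVert_length]
  exact hvbd

end Summit.CriticalPhenomena.PercolationContinuityZ3.Theorems

end
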